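import Literature.Geometry.Riemannian.RicciFlowHeatKernelFn
import HarnessLib

/-!
# Differentiating a heat-kernel functional `∫_X Λ(K(γ(σ),t;y,s)) dg_s(y)` along a curve of base
# points (Bamler 2020a, §4–§5)

R. Bamler, *Entropy and heat kernel bounds on a Ricci flow background*, arXiv:2008.07093 (2020a),
differentiates functionals of the conjugate heat kernel `K(x,t;y,s)` in the base point `x` (along
curves / in the direction of a vector `v ∈ T_x M`) under the `dg_s(y)`-integral, e.g. in the proof
of the `L¹`-form of the gradient estimate (Prop. 4.2: `∫ |∇_x K(x,t;·,s)| dg_s`) and of the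
base-point dependence of the pointed Nash entropy (Thm. 5.9). This file supplies that calculus
step for the tree's kernel function `K = hflow.heatKernelFn hh hR` (`RicciFlowHeatKernelFn.lean`) of
a Ricci flow `hflow` on `[a, T]` of a `C^∞` family of Riemannian metrics on a closed connected
manifold `M`:

* `hasDerivAt_setIntegral_comp_heatKernelFn_curve` — for `a < s < t < T`, a `C^∞` curve
  `γ : ℝ → M`, `Λ ∈ C¹((0, ∞))` and `X ⊆ M`,
  `d/dσ ∫_X Λ(K(γ σ, t; y, s)) dg_s(y) = ∫_X Λ'(K(γ σ, t; y, s)) ∂_σ K(γ σ, t; y, s) dg_s(y)`.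

Proof: dominated differentiation under the integral sign
(`hasDerivAt_integral_of_dominated_loc_of_deriv_le`), packaged as the abstract lemma
`hasDerivAt_integral_comp_of_norm_deriv_le` (a jointly continuous positive kernel on the compact
`M`, differentiable in the parameter with locally uniformly bounded derivative, composed with a
`C¹` function of `(0, ∞)`). The uniform bound on `∂_σ K(γ σ, t; y, s)` comes from the Lipschitz
bound of `K(·,t;y,s)` for the distance `d_{g_t}` (`heatKernelFn_lipschitz_basePoint`) and the
bound `d_{g}(γ σ, γ σ') ≤ C |σ' − σ|` for `C¹` curves on compact parameter intervals
(`exists_edist_le_mul_sub_of_contMDiff`, from `d ≤ length` and continuity of the speed).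

Everything is proved; no definitions, no named facts. What is NOT here: higher derivatives,
non-compact `M`, time-dependent `Λ`, or the evaluation of `∂_σ K` through `∇_x K`.

## References

* R. H. Bamler, *Entropy and heat kernel bounds on a Ricci flow background*, arXiv:2008.07093
  (2020), §4 (Prop. 4.2), §5 (Thm. 5.9). [Bamler2020Entropy]
-/

noncomputable section

open Bundle Set Function Filter Manifold MeasureTheory Measure TopologicalSpace
open scoped Manifold ContDiff Topology ENNReal NNReal

namespace Literature.Geometry.Riemannian

open Lorentzian Lorentzian.PseudoRiemannianMetric

/-! ### Distance along a `C¹` curve -/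

section Curve

variable {E : Type*} [NormedAddCommGroup E] [NormedSpace ℝ E] [FiniteDimensional ℝ E]
  {H : Type*} [TopologicalSpace H] {I : ModelWithCorners ℝ E H}
  {M : Type*} [TopologicalSpace M] [ChartedSpace H M] [IsManifold I ∞ M]

/-- **A `C¹` curve is Lipschitz for the Riemannian distance on compact parameter intervals**:
for a Riemannian metric `g`, a `C¹` curve `γ : ℝ → M` and `[α, β]` there is `C ≥ 0` with
`d_g(γ σ, γ σ') ≤ C (σ' − σ)` for `α ≤ σ ≤ σ' ≤ β` (`d ≤ length = ∫ |γ'|_g`, and the speed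
`|γ'|_g` is continuous, hence bounded on `[α, β]`). [folklore] -/
theorem exists_edist_le_mul_sub_of_contMDiff
    (g : PseudoRiemannianMetric I ∞ E (TangentSpace I : M → Type _)) (hg : g.IsRiemannian)
    {γ : ℝ → M} (hγ : ContMDiff 𝓘(ℝ, ℝ) I 1 γ) (α β : ℝ) :
    ∃ C : ℝ, 0 ≤ C ∧ ∀ ⦃σ σ' : ℝ⦄, α ≤ σ → σ ≤ σ' → σ' ≤ β →
      g.edist hg (γ σ) (γ σ') ≤ ENNReal.ofReal (C * (σ' - σ)) := by
  letI := g.riemannianBundle hg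
  haveI := g.isContinuousRiemannianBundle hg
  -- the tangent lift of `γ` is continuous
  have hlift : Continuous (fun τ ↦
      (TotalSpace.mk' E (γ τ) (mfderiv 𝓘(ℝ, ℝ) I γ τ 1) : TangentBundle I M)) := by
    have h1 := hγ.continuous_tangentMap le_rfl
    have h2 : Continuous (fun τ : ℝ ↦ (TotalSpace.mk' ℝ τ (1 : ℝ) : TangentBundle 𝓘(ℝ, ℝ) ℝ)) := by
      have : Continuous ((tangentBundleModelSpaceHomeomorph 𝓘(ℝ, ℝ)).symm ∘
          fun τ : ℝ ↦ (τ, (1 : ℝ))) := (Homeomorph.continuous _).comp (by fun_prop)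
      exact this
    exact h1.comp h2
  -- hence so is the squared speed `⟪γ', γ'⟫`
  have hsp : Continuous (fun τ ↦ inner ℝ (mfderiv 𝓘(ℝ, ℝ) I γ τ 1) (mfderiv 𝓘(ℝ, ℝ) I γ τ 1)) :=
    hlift.inner_bundle hlift
  obtain ⟨S, hS⟩ := (isCompact_Icc (a := α) (b := β)).exists_bound_of_continuousOn hsp.continuousOn
  refine ⟨Real.sqrt S, Real.sqrt_nonneg _, fun σ σ' hασ hσσ' hσ'β ↦ ?_⟩
  have hd : g.edist hg (γ σ) (γ σ') ≤ pathELength I γ σ σ' :=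
    riemannianEDist_le_pathELength hγ.contMDiffOn rfl rfl hσσ'
  refine hd.trans ?_
  rw [pathELength_eq_lintegral_mfderiv_Icc]
  have hspeed : ∀ τ ∈ Icc σ σ', ‖mfderiv 𝓘(ℝ, ℝ) I γ τ 1‖ₑ ≤ ENNReal.ofReal (Real.sqrt S) := by
    intro τ hτ
    have h := hS τ ⟨hασ.trans hτ.1, hτ.2.trans hσ'β⟩
    rw [Real.norm_eq_abs] at h
    rw [← ofReal_norm]
    refine ENNReal.ofReal_le_ofReal ?_
    rw [← Real.sqrt_sq (norm_nonneg _), ← real_inner_self_eq_norm_sq]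
    exact Real.sqrt_le_sqrt ((le_abs_self _).trans h)
  calc ∫⁻ τ in Icc σ σ', ‖mfderiv 𝓘(ℝ, ℝ) I γ τ 1‖ₑ
      ≤ ∫⁻ _ in Icc σ σ', ENNReal.ofReal (Real.sqrt S) :=
        setLIntegral_mono' measurableSet_Icc fun τ hτ ↦ hspeed τ hτ
    _ = ENNReal.ofReal (Real.sqrt S * (σ' - σ)) := by
        rw [setLIntegral_const, Real.volume_Icc, ← ENNReal.ofReal_mul (Real.sqrt_nonneg _)]

end Curve

/-! ### Differentiation under the integral sign for `∫ Λ(K(σ, y)) dμ(y)` -/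

section Abstract

variable {M : Type*} [TopologicalSpace M] [CompactSpace M] [MeasurableSpace M]
  [OpensMeasurableSpace M]

/-- **`d/dσ ∫ Λ(K(σ,y)) dμ(y) = ∫ Λ'(K(σ₀,y)) ∂_σK(σ₀,y) dμ(y)`** for a finite measure `μ` on the
compact `M`, a jointly continuous positive kernel `K` on `ℝ × M` which is differentiable in `σ`
with `|∂_σ K| ≤ B` on `(σ₀ − ε, σ₀ + ε) × M`, and `Λ ∈ C¹((0, ∞))` (dominated differentiation
under the integral sign: on `[σ₀ − ε, σ₀ + ε] × M` the kernel ranges in a compact subset of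
`(0, ∞)`, where `Λ'` is bounded; `∂_σ K(σ₀, ·)` is measurable as a pointwise limit of difference
quotients). [folklore] -/
theorem hasDerivAt_integral_comp_of_norm_deriv_le (μ : Measure M) [IsFiniteMeasure μ]
    {K : ℝ → M → ℝ} (hKc : Continuous fun p : ℝ × M ↦ K p.1 p.2)
    (hKd : ∀ y σ, DifferentiableAt ℝ (fun σ ↦ K σ y) σ) (hKpos : ∀ σ y, 0 < K σ y)
    {σ₀ ε B : ℝ} (hε : 0 < ε)
    (hB : ∀ y, ∀ σ ∈ Ioo (σ₀ - ε) (σ₀ + ε), ‖deriv (fun σ ↦ K σ y) σ‖ ≤ B)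
    {Λ : ℝ → ℝ} (hΛ : ContDiffOn ℝ 1 Λ (Ioi 0)) :
    HasDerivAt (fun σ ↦ ∫ y, Λ (K σ y) ∂μ)
      (∫ y, deriv Λ (K σ₀ y) * deriv (fun σ ↦ K σ y) σ₀ ∂μ) σ₀ := by
  -- slices and derivatives of the kernel
  have hKs : ∀ σ, Continuous fun y ↦ K σ y := fun σ ↦
    hKc.comp (continuous_const.prodMk continuous_id)
  have hKD : ∀ y σ, HasDerivAt (fun σ ↦ K σ y) (deriv (fun σ ↦ K σ y) σ) σ := fun y σ ↦
    (hKd y σ).hasDerivAt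
  -- `Λ` and `Λ'` on `(0, ∞)`
  have hΛ' : ContinuousOn (deriv Λ) (Ioi 0) := hΛ.continuousOn_deriv_of_isOpen isOpen_Ioi le_rfl
  have hΛd : ∀ x : ℝ, 0 < x → HasDerivAt Λ (deriv Λ x) x := fun x hx ↦
    ((hΛ.differentiableOn one_ne_zero).differentiableAt (Ioi_mem_nhds hx)).hasDerivAt
  -- the compact range of `K` over `[σ₀ - ε, σ₀ + ε] × M`, and a bound for `Λ'` there
  set J : Set ℝ := (fun p : ℝ × M ↦ K p.1 p.2) '' (Icc (σ₀ - ε) (σ₀ + ε) ×ˢ univ) with hJ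
  have hJc : IsCompact J := (isCompact_Icc.prod isCompact_univ).image hKc
  have hJpos : J ⊆ Ioi 0 := by
    rintro _ ⟨p, -, rfl⟩
    exact hKpos p.1 p.2
  obtain ⟨D, hD⟩ := hJc.exists_bound_of_continuousOn (hΛ'.mono hJpos)
  -- measurability of the integrands
  have hF_meas : ∀ᶠ σ in 𝓝 σ₀, AEStronglyMeasurable (fun y ↦ Λ (K σ y)) μ :=
    Eventually.of_forall fun σ ↦
      (hΛ.continuousOn.comp_continuous (hKs σ) fun y ↦ hKpos σ y).aestronglyMeasurable
  have hF_int : Integrable (fun y ↦ Λ (K σ₀ y)) μ :=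
    (hΛ.continuousOn.comp_continuous (hKs σ₀) fun y ↦ hKpos σ₀ y).integrable_of_hasCompactSupport
      (HasCompactSupport.of_compactSpace _)
  have hm1 : Continuous fun y ↦ deriv Λ (K σ₀ y) :=
    hΛ'.comp_continuous (hKs σ₀) fun y ↦ hKpos σ₀ y
  have hm2 : Measurable fun y ↦ deriv (fun σ ↦ K σ y) σ₀ := by
    have hu : Tendsto (fun n : ℕ ↦ (1 : ℝ) / ((n : ℝ) + 1)) atTop (𝓝[≠] 0) :=
      tendsto_nhdsWithin_iff.2 ⟨tendsto_one_div_add_atTop_nhds_zero_nat,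
        Eventually.of_forall fun n ↦ (by positivity : (0 : ℝ) < 1 / ((n : ℝ) + 1)).ne'⟩
    refine measurable_of_tendsto_metrizable
      (f := fun (n : ℕ) (y : M) ↦ ((1 : ℝ) / ((n : ℝ) + 1))⁻¹ •
        (K (σ₀ + (1 : ℝ) / ((n : ℝ) + 1)) y - K σ₀ y))
      (fun n ↦ ?_) ?_
    · exact (((hKs _).sub (hKs σ₀)).const_smul (((1 : ℝ) / ((n : ℝ) + 1))⁻¹)).measurable
    · rw [tendsto_pi_nhds]
      intro y
      exact (hKD y σ₀).tendsto_slope_zero.comp hu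
  have hF'_meas : AEStronglyMeasurable
      (fun y ↦ deriv Λ (K σ₀ y) * deriv (fun σ ↦ K σ y) σ₀) μ :=
    (hm1.measurable.mul hm2).aestronglyMeasurable
  -- the uniform bound on `∂_σ (Λ ∘ K)` over `(σ₀ - ε, σ₀ + ε) × M`
  have h_bound : ∀ᵐ y ∂μ, ∀ σ ∈ Ioo (σ₀ - ε) (σ₀ + ε),
      ‖deriv Λ (K σ y) * deriv (fun σ ↦ K σ y) σ‖ ≤ D * B := by
    refine Eventually.of_forall fun y σ hσ ↦ ?_
    rw [norm_mul]
    have h1 : ‖deriv Λ (K σ y)‖ ≤ D := hD _ ⟨(σ, y), ⟨Ioo_subset_Icc_self hσ, mem_univ _⟩, rfl⟩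
    exact mul_le_mul h1 (hB y σ hσ) (norm_nonneg _) ((norm_nonneg _).trans h1)
  have h_diff : ∀ᵐ y ∂μ, ∀ σ ∈ Ioo (σ₀ - ε) (σ₀ + ε),
      HasDerivAt (fun σ ↦ Λ (K σ y)) (deriv Λ (K σ y) * deriv (fun σ ↦ K σ y) σ) σ :=
    Eventually.of_forall fun y σ _ ↦ (hΛd _ (hKpos σ y)).comp σ (hKD y σ)
  exact (hasDerivAt_integral_of_dominated_loc_of_deriv_le (μ := μ)
    (F := fun σ y ↦ Λ (K σ y)) (F' := fun σ y ↦ deriv Λ (K σ y) * deriv (fun σ ↦ K σ y) σ)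
    (x₀ := σ₀) (s := Ioo (σ₀ - ε) (σ₀ + ε)) (bound := fun _ ↦ D * B)
    (Ioo_mem_nhds (by linarith) (by linarith)) hF_meas hF_int hF'_meas h_bound
    (integrable_const _) h_diff).2

end Abstract

/-! ### The heat kernel along a curve of base points -/

section HeatKernel

variable {m : ℕ} {H : Type*} [TopologicalSpace H]
  {I : ModelWithCorners ℝ (EuclideanSpace ℝ (Fin m)) H} [I.Boundaryless]
  {M : Type*} [TopologicalSpace M] [ChartedSpace H M] [IsManifold I ∞ M]
  [T2Space M] [CompactSpace M] [SecondCountableTopology M] [MeasurableSpace M] [BorelSpace M]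
  [PreconnectedSpace M]
  {h : ℝ → PseudoRiemannianMetric I ∞ (EuclideanSpace ℝ (Fin m)) (TangentSpace I : M → Type _)}
  {cov : ℝ → CovariantDerivative I (EuclideanSpace ℝ (Fin m)) (TangentSpace I : M → Type _)}
  {a T : ℝ}

/-- **Differentiating `∫_X Λ(K(γ(σ),t;y,s)) dg_s(y)` along a curve of base points** (the
differentiation-under-the-integral step of Bamler 2020a, §4–§5, e.g. Prop. 4.2 and Thm. 5.9).
For a Ricci flow on `[a, T]` of a `C^∞` family of Riemannian metrics on a closed connected
manifold, `a < s < t < T`, a `C^∞` curve `γ : ℝ → M`, `Λ ∈ C¹((0, ∞))` and `X ⊆ M`: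
`σ ↦ ∫_X Λ(K(γ σ,t;y,s)) dg_s(y)` has derivative
`∫_X Λ'(K(γ σ₀,t;y,s)) · ∂_σ|_{σ₀} K(γ σ,t;y,s) dg_s(y)` at every `σ₀` (`K > 0` is `C^∞` in the
base point, jointly continuous, and `∂_σ K(γ σ,t;·,s)` is bounded uniformly on `M`, locally in
`σ`, by the `d_{g_t}`-Lipschitz bound of `K(·,t;y,s)` and the Lipschitz bound of `γ` for `d_{g_t}`).
[cite: Bamler2020Entropy, §4 (Prop. 4.2), §5 (Thm. 5.9)] -/
theorem hasDerivAt_setIntegral_comp_heatKernelFn_curve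
    (hflow : IsRicciFlow h cov (Icc a T)) (hh : IsContMDiffFamilyOn ∞ h univ)
    (hR : ∀ r, (h r).IsRiemannian) {s t : ℝ} (has : a < s) (hst : s < t) (htT : t < T)
    {γ : ℝ → M} (hγ : ContMDiff 𝓘(ℝ, ℝ) I ∞ γ) {Λ : ℝ → ℝ} (hΛ : ContDiffOn ℝ 1 Λ (Ioi 0))
    {X : Set M} (_hX : MeasurableSet X) (σ₀ : ℝ) :
    HasDerivAt (fun σ ↦ ∫ y in X, Λ (hflow.heatKernelFn hh hR t (γ σ) (y, s)) ∂(h s).riemVolume)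
      (∫ y in X, deriv Λ (hflow.heatKernelFn hh hR t (γ σ₀) (y, s)) *
        deriv (fun σ ↦ hflow.heatKernelFn hh hR t (γ σ) (y, s)) σ₀ ∂(h s).riemVolume) σ₀ := by
  have ht : t ∈ Ioc a T := ⟨has.trans hst, htT.le⟩
  have hs : s ∈ Ioo a t := ⟨has, hst⟩
  have hsT : s ∈ Ioo a T := ⟨has, hst.trans htT⟩
  have h1le : (1 : ℕ∞ω) ≤ (∞ : ℕ∞ω) := by exact_mod_cast le_top
  haveI : IsFiniteMeasure (h s).riemVolume := ⟨(h s).riemVolume_univ_lt_top⟩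
  -- positivity, joint continuity and smoothness in `σ` of `(σ, y) ↦ K(γ σ, t; y, s)`
  have hKpos : ∀ σ y, 0 < hflow.heatKernelFn hh hR t (γ σ) (y, s) := fun σ y ↦
    hflow.heatKernelFn_pos hh hR ht (γ σ) ⟨mem_univ y, hs⟩
  have hKc : Continuous fun p : ℝ × M ↦ hflow.heatKernelFn hh hR t (γ p.1) (p.2, s) := by
    have hι : Continuous fun p : ℝ × M ↦ (((γ p.1, t) : M × ℝ), p.2) :=
      ((hγ.continuous.comp continuous_fst).prodMk continuous_const).prodMk continuous_snd
    exact (hflow.continuousOn_heatKernelFn_basePoint hh hR hsT).comp_continuous hι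
      fun p ↦ ⟨⟨mem_univ _, hst, htT.le⟩, mem_univ _⟩
  have hKsm : ∀ y, ContDiff ℝ ∞ fun σ ↦ hflow.heatKernelFn hh hR t (γ σ) (y, s) := fun y ↦
    contMDiff_iff_contDiff.1 ((hflow.contMDiffOn_heatKernelFn_basePoint hh hR hsT y).comp_contMDiff
      (hγ.prodMk contMDiff_const) fun σ ↦ ⟨mem_univ _, hst, htT⟩)
  have hKd : ∀ y σ, DifferentiableAt ℝ (fun σ ↦ hflow.heatKernelFn hh hR t (γ σ) (y, s)) σ :=
    fun y σ ↦ ((hKsm y).differentiable (by simp)).differentiableAt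
  -- the Lipschitz bound in the base point and the Lipschitz bound of `γ` for `d_{g_t}`
  obtain ⟨L, hL⟩ := hflow.heatKernelFn_lipschitz_basePoint hh hR ht (a' := (a + s) / 2)
    (b' := (s + t) / 2) (by linarith) (by linarith) (by linarith)
  obtain ⟨C, hC0, hC⟩ := exists_edist_le_mul_sub_of_contMDiff (h t) (hR t) (hγ.of_le h1le)
    (σ₀ - 2) (σ₀ + 2)
  have hsI : s ∈ Icc ((a + s) / 2) ((s + t) / 2) := ⟨by linarith, by linarith⟩
  have hlip : ∀ y, ∀ σ ∈ Icc (σ₀ - 2) (σ₀ + 2), ∀ σ' ∈ Icc (σ₀ - 2) (σ₀ + 2),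
      |hflow.heatKernelFn hh hR t (γ σ') (y, s) - hflow.heatKernelFn hh hR t (γ σ) (y, s)| ≤
        max L 0 * C * |σ' - σ| := by
    intro y σ hσ σ' hσ'
    wlog hle : σ ≤ σ' generalizing σ σ' with H'
    · have h' := H' σ' hσ' σ hσ (le_of_not_ge hle)
      rwa [abs_sub_comm, abs_sub_comm σ σ'] at h'
    have h1 := hL (γ σ') (γ σ) (y, s) ⟨mem_univ _, hsI⟩
    have h2 : (h t).edist (hR t) (γ σ') (γ σ) ≤ ENNReal.ofReal (C * (σ' - σ)) := by
      rw [PseudoRiemannianMetric.edist_comm]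
      exact hC hσ.1 hle hσ'.2
    have h0 : 0 ≤ max L 0 * (C * (σ' - σ)) :=
      mul_nonneg (le_max_right _ _) (mul_nonneg hC0 (sub_nonneg.2 hle))
    have h3 : ENNReal.ofReal
        |hflow.heatKernelFn hh hR t (γ σ') (y, s) - hflow.heatKernelFn hh hR t (γ σ) (y, s)| ≤
        ENNReal.ofReal (max L 0 * (C * (σ' - σ))) :=
      calc _ ≤ ENNReal.ofReal L * (h t).edist (hR t) (γ σ') (γ σ) := h1
        _ ≤ ENNReal.ofReal (max L 0) * ENNReal.ofReal (C * (σ' - σ)) :=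
          mul_le_mul' (ENNReal.ofReal_le_ofReal (le_max_left _ _)) h2
        _ = ENNReal.ofReal (max L 0 * (C * (σ' - σ))) :=
          (ENNReal.ofReal_mul (le_max_right _ _)).symm
    rw [abs_of_nonneg (sub_nonneg.2 hle), mul_assoc]
    exact (ENNReal.ofReal_le_ofReal_iff h0).1 h3
  have hB : ∀ y, ∀ σ ∈ Ioo (σ₀ - 1) (σ₀ + 1),
      ‖deriv (fun σ ↦ hflow.heatKernelFn hh hR t (γ σ) (y, s)) σ‖ ≤ max L 0 * C := by
    intro y σ hσ
    refine norm_deriv_le_of_lip' (mul_nonneg (le_max_right _ _) hC0) ?_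
    filter_upwards [Icc_mem_nhds (by linarith [hσ.1] : σ₀ - 2 < σ)
      (by linarith [hσ.2] : σ < σ₀ + 2)] with σ' hσ'
    rw [Real.norm_eq_abs, Real.norm_eq_abs]
    exact hlip y σ ⟨by linarith [hσ.1], by linarith [hσ.2]⟩ σ' hσ'
  exact hasDerivAt_integral_comp_of_norm_deriv_le ((h s).riemVolume.restrict X)
    (K := fun σ y ↦ hflow.heatKernelFn hh hR t (γ σ) (y, s)) hKc hKd hKpos one_pos hB hΛ

end HeatKernel

end Literature.Geometry.Riemannian

end
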